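import Summits.HodgeConjecture.HodgeConjecture.Theses.BoundaryReadout
import Summits.HodgeConjecture.HodgeConjecture.Theorems.BoundaryReadoutBoundaryAbsolutenessStubRationalDescent
import Summits.HodgeConjecture.HodgeConjecture.Theorems.BoundaryReadoutBoundaryAbsolutenessStubTypeDescent
import Summits.HodgeConjecture.HodgeConjecture.Theorems.BoundaryReadoutBoundaryAbsolutenessStubConjugateFibre
import Summits.HodgeConjecture.HodgeConjecture.Theorems.BoundaryReadoutBoundaryAbsolutenessStubSmoothFibreLocus
import Summits.HodgeConjecture.HodgeConjecture.Theorems.BoundaryReadoutBoundaryAbsolutenessStubVanishingPropagation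
import Literature.AlgebraicGeometry.HodgeTheory.ConjugationChartUniqueness
import Literature.AlgebraicGeometry.HodgeTheory.HodgeTypeExteriorProduct
import Literature.AlgebraicGeometry.Motives.BaseChangeProofs
import Literature.AlgebraicGeometry.Motives.CyclesBaseChange
import Literature.AlgebraicGeometry.Motives.CurveNet
import HarnessLib

/-!
# Crux `BoundaryAbsoluteness` (stmt-HodgeConjecture-15913, route `BoundaryReadout`) — the line
# `typewise_readout` assembled: the crux modulo the named facts of conjugation

`BoundaryAbsoluteness` (boundary Principle B): for `f : 𝒳 ⟶ C` surjective from a smooth projective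
variety onto a smooth projective curve, finitely many smooth projective pieces `g_i : Y_i ⟶ X_o`
jointly covering the fibre over `o`, and a rational `(p,p)` class `ξ ∈ H²ᵖ(𝒳(ℂ); ℂ)` whose restrictions
`ξ|Y_i` are absolute Hodge: `ξ|X_t` is absolute Hodge on every smooth projective fibre `X_t`.

This file assembles the registered line `Cruxes/BoundaryAbsoluteness/Lines/typewise_readout.lean` from
its LANDED stubs:

* TOPOLOGY (unconditional, all proved in the tree): `boundaryReadout_fibreKernelInclusion` — on every
  conjugate family `f^σ : 𝒳^σ ⟶ C^σ` a complex class killed by the conjugate covering pieces of `X_o^σ`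
  dies on every smooth projective fibre (`stub_conjugateFibre` σ-bookkeeping, `stub_smoothFibreLocus`
  EGA IV 17.5.1, `stub_vanishingPropagation` Hodge III 8.2.7 + tube + Ehresmann over the smooth locus);
* LINEAR ALGEBRA / HODGE THEORY ON ONE VARIETY (unconditional): `stub_rationalDescent`,
  `stub_typeDescent` (rationality and Hodge type descend along a kernel inclusion);
* σ-INFRASTRUCTURE (CONDITIONAL on printed theorems filed as Literature named facts): existence of
  conjugates is `exists_isConjugateClass_of_facts'` from (J) `jouanolou_cohomologyChart`,
  (G) `grothendieck_comparison_realize_surjective`, (C) `conj_realize_mem_cclosedSmoothForms`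
  (`Literature/AlgebraicGeometry/HodgeTheory/ConjugationChartExistence`, (R) discharged in
  `RationallyNormalisedDeRhamFamily`); functoriality + single-valuedness of conjugation follows from the
  named fact `chartConjugation_canonical` (`ConjugationChartUniqueness`, Charles–Schnell §11.2.2
  (11.2.2)–(11.2.3): every chart computes the canonical `σ`-linear, natural `α ↦ α^σ`), derived inline.

Main results: `boundaryReadout_vanishingReadout` / `_rationalReadout` / `_typeReadout` (σ-free,
UNCONDITIONAL: a global class killed by — resp. rational on, resp. of type `(a,b)` on — the covering
pieces of one fibre is killed by — resp. rational on, resp. of type `(a,b)` on — every smooth projective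
fibre; in particular the crux's hypotheses `IsRationalClass ξ`, `IsOfHodgeType … ξ` are removable),
`boundaryReadout_fibreKernelInclusion` (the same on every conjugate family, unconditional),
`boundaryReadout_kernelDescent_of_facts` (absoluteness descends along conjugation-stable kernel
inclusions, from (J)(G)(C) + `chartConjugation_canonical`) and `boundaryAbsoluteness_of_facts` — the
crux BY NAME from the four named facts. CONDITIONAL (the item stays open until the facts are discharged; any
proof must construct conjugation charts on the fibres,
`Theorems/BoundaryAbsoluteness/Negative/HCSafety.nonempty_conjugationChart_fibre_of_boundaryAbsoluteness`).

## References

* [CharlesSchnell2014Notes] F. Charles, C. Schnell, Notes on absolute Hodge classes, in *Hodge Theory*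
  (Princeton Math. Notes 49, 2014), §11.2.2 (11.2.1)–(11.2.3), Def. 11.2.3, Thm. 11.3.7–11.3.8.
* [Deligne1982HodgeCycles] P. Deligne, Hodge cycles on abelian varieties, LNM 900 (1982), §2 Thm. 2.12.
* [DeligneHodgeIII1974] P. Deligne, Théorie de Hodge III, Publ. Math. IHÉS 44 (1974), Prop. 8.2.7.
-/

-- `Summit.HodgeConjecture.HodgeConjecture.Theorems` is the mandated namespace (single-problem summit),
-- flagged by `linter.dupNamespace`; the lakefile turns the linter off tree-wide, restated here.
set_option linter.dupNamespace false

noncomputable section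

open CategoryTheory AlgebraicGeometry
open Literature.AlgebraicGeometry.Motives Literature.AlgebraicGeometry.HodgeTheory
open Summit.HodgeConjecture.HodgeConjecture.Theses.BoundaryReadout (BoundaryAbsoluteness)

namespace Summit.HodgeConjecture.HodgeConjecture.Theorems

/-- **Every conjugation chart computes the canonical conjugate** (from the named fact
`chartConjugation_canonical`): if `c'` is a `σ`-conjugate of `c ∈ Hᵏ(X(ℂ); ℂ)` on a smooth projective `X`
(in ANY chart `D`: affine `π : Y ⟶ X` with `(π^σ)^*` injective, analytic models, a natural rationally
normalised de Rham family), then `c' = θ_X c` for the canonical conjugation `θ`: the chart's defining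
relations and (iii) of the fact give `A'^*(θ_Y(π^* c)) = A'^*((π^σ)^* c')`, naturality (ii) along the
affine `π` gives `θ_Y(π^* c) = (π^σ)^*(θ_X c)`, and `A'^*`, `(π^σ)^*` are injective.
[cite: CharlesSchnell2014Notes, §11.2.2 (11.2.2)–(11.2.3)] -/
theorem isConjugateClass_eq_canonical_of_chartConjugation_canonical {σ : ℂ ≃+* ℂ} {k : ℕ}
    (θ : ∀ X : SchemeOver ℂ, complexBetti X k → complexBetti (conjugateVariety σ X) k)
    (hθnat : ∀ ⦃n : ℕ⦄ ⦃X : SchemeOver ℂ⦄, IsSmoothProjective n X →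
      ∀ ⦃Y : SchemeOver ℂ⦄ (g : Y ⟶ X),
        ((∃ m, IsSmoothProjective m Y) ∨ (IsAffine Y.left ∧ ∃ m, SmoothOfRelativeDimension m Y.hom)) →
        ∀ c : complexBetti X k, θ Y (complexBetti.map g k c) = complexBetti.map (conjHom σ g) k (θ X c))
    (hθchart : ∀ (E : Type) [NormedAddCommGroup E] [NormedSpace ℂ E] [FiniteDimensional ℂ E]
      (e : Literature.NumberTheory.Transcendental.ComplexDeRhamIsoFamily E), e.IsNatural →
      IsRationalDeRhamFamily e k →
      ∀ (m : ℕ) (Y : SchemeOver ℂ) [IsAffine Y.left] [SmoothOfRelativeDimension m Y.hom]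
        (A : AnalyticModel E m Y) (A' : AnalyticModel E m (conjugateVariety σ Y))
        (ξ : AlgFormExpr Y k)
        (hξ : ξ.realize A ∈ Literature.NumberTheory.Transcendental.cclosedSmoothForms E A.carrier k)
        (hξ' : (ξ.conj σ).realize A' ∈
          Literature.NumberTheory.Transcendental.cclosedSmoothForms E A'.carrier k)
        (c : complexBetti Y k),
        A.pullback k c = e A.carrier k
          (Literature.NumberTheory.Transcendental.complexDeRhamCohomology.mk E A.carrier k ⟨_, hξ⟩) →
        A'.pullback k (θ Y c) = e A'.carrier k
          (Literature.NumberTheory.Transcendental.complexDeRhamCohomology.mk E A'.carrier k ⟨_, hξ'⟩))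
    {n : ℕ} {X : SchemeOver ℂ} (hX : IsSmoothProjective n X) {c : complexBetti X k}
    {c' : complexBetti (conjugateVariety σ X) k} (hc' : IsConjugateClass σ X k c c') :
    c' = θ X c := by
  obtain ⟨D, ξ, hξ, hξ', h1, h2⟩ := hc'
  -- (iii): the chart computes `θ` on the affine `D.Y`
  have h3 : D.anConj.pullback k (θ D.Y (complexBetti.map D.π k c)) =
      D.deRham D.anConj.carrier k
        (Literature.NumberTheory.Transcendental.complexDeRhamCohomology.mk D.E D.anConj.carrier k ⟨_, hξ'⟩) :=
    hθchart D.E D.deRham D.deRham_isNatural D.deRham_isRational D.m D.Y D.an D.anConj ξ hξ hξ' _ h1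
  -- so `θ_Y (π^* c) = (π^σ)^* c'` (the comparison pull-back of an analytic model is injective)
  have h4 : θ D.Y (complexBetti.map D.π k c) = complexBetti.map (conjHom σ D.π) k c' :=
    D.anConj.pullback_injective k (h3.trans h2.symm)
  -- (ii): naturality along the affine `π : D.Y ⟶ X`
  have h5 : θ D.Y (complexBetti.map D.π k c) = complexBetti.map (conjHom σ D.π) k (θ X c) :=
    hθnat hX D.π (Or.inr ⟨D.isAffine, D.m, D.smooth⟩) c
  exact D.injective_map (h4.symm.trans h5)

/-- **Conjugation is natural and single-valued, granted `chartConjugation_canonical`**: for a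
`ℂ`-morphism `g : Y ⟶ X` of smooth projective varieties, any `σ`-conjugate `c'` of `c` and any
`σ`-conjugate `d'` of `g^* c` satisfy `(g^σ)^* c' = d'` (both are values of the canonical, natural `θ`).
This is the σ-infrastructure statement `ConjugateNaturality` (registered stub `stub_conjugateNaturality` of
the lines of stmt-HodgeConjecture-15913) modulo the named fact; stated with the fact as explicit first
hypothesis. [cite: CharlesSchnell2014Notes, §11.2.2 (11.2.2)–(11.2.3)] -/
theorem conjugateNaturality_of_chartConjugation_canonical (hN : chartConjugation_canonical)
    ⦃m n : ℕ⦄ ⦃Y X : SchemeOver ℂ⦄ (hY : IsSmoothProjective m Y) (hX : IsSmoothProjective n X)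
    (g : Y ⟶ X) (σ : ℂ ≃+* ℂ) (k : ℕ) (c : complexBetti X k)
    (c' : complexBetti (conjugateVariety σ X) k) (d' : complexBetti (conjugateVariety σ Y) k)
    (hc' : IsConjugateClass σ X k c c') (hd' : IsConjugateClass σ Y k (complexBetti.map g k c) d') :
    complexBetti.map (conjHom σ g) k c' = d' := by
  obtain ⟨θ, -, hθnat, hθchart⟩ := hN σ k
  have hc : c' = θ X c :=
    isConjugateClass_eq_canonical_of_chartConjugation_canonical θ hθnat hθchart hX hc'
  have hd : d' = θ Y (complexBetti.map g k c) :=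
    isConjugateClass_eq_canonical_of_chartConjugation_canonical θ hθnat hθchart hY hd'
  rw [hd, hc]
  exact (hθnat hX g (Or.inl ⟨m, hY⟩) c).symm

/-- **Vanishing readout (σ-free, unconditional).** For `f : 𝒳 ⟶ C` surjective from a smooth projective
variety onto a smooth projective curve and smooth projective pieces `g_i : Y_i ⟶ X_o` jointly covering
the fibre over `o`: a class `x ∈ Hᵏ(𝒳(ℂ); ℂ)` with `(g_i ≫ ι_o)^* x = 0` for all `i` has `ι_t^* x = 0` on
every smooth projective fibre `X_t` (Hodge III 8.2.7 + tube + Ehresmann over the smooth-fibre locus: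
`stub_smoothFibreLocus`, `stub_vanishingPropagation`). [cite: DeligneHodgeIII1974, Prop. 8.2.7]
[cite: VoisinHodgeI2002, §9.2.1 and Thm. 9.3] -/
theorem boundaryReadout_vanishingReadout {N : ℕ} {𝒳 C : SchemeOver ℂ} (f : 𝒳 ⟶ C) (o : AlgPoints C ℂ)
    (h𝒳 : IsSmoothProjective N 𝒳) (hC : IsSmoothProjective 1 C) (hf : Function.Surjective f.left.base)
    {ι : Type} [Finite ι] {m : ι → ℕ} {Y : ι → SchemeOver ℂ} (g : ∀ i, Y i ⟶ fiberOver f o)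
    (hY : ∀ i, IsSmoothProjective (m i) (Y i))
    (hcov : ∀ x : ↥(fiberOver f o).left, ∃ (i : ι) (y : ↥(Y i).left), (g i).left.base y = x)
    (k : ℕ) (x : complexBetti 𝒳 k) (hx : ∀ i, complexBetti.map (g i ≫ fiberι f o) k x = 0)
    (t : AlgPoints C ℂ) {n : ℕ} (ht : IsSmoothProjective n (fiberOver f t)) :
    complexBetti.map (fiberι f t) k x = 0 := by
  obtain ⟨W, d, hW, hmem⟩ := stub_smoothFibreLocus f h𝒳 hC hf
  exact stub_vanishingPropagation f o h𝒳 hC hf g hY hcov W d hW k x hx t (hmem t ht)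

/-- **Rationality readout (σ-free, unconditional).** With `f`, `o`, `g_i` as above: a class
`Θ ∈ Hᵏ(𝒳(ℂ); ℂ)` whose restrictions to the covering pieces `Y_i` are RATIONAL has rational restriction
to every smooth projective fibre `X_t` (`boundaryReadout_vanishingReadout` + `stub_rationalDescent`). In
particular the hypothesis `IsRationalClass ξ` of `BoundaryAbsoluteness` is implied fibrewise by the
hypotheses on the pieces. [cite: Deligne1982HodgeCycles, §2 Lemma 2.13] [cite: DeligneHodgeIII1974, Prop. 8.2.7] -/
theorem boundaryReadout_rationalReadout {N : ℕ} {𝒳 C : SchemeOver ℂ} (f : 𝒳 ⟶ C) (o : AlgPoints C ℂ)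
    (h𝒳 : IsSmoothProjective N 𝒳) (hC : IsSmoothProjective 1 C) (hf : Function.Surjective f.left.base)
    {ι : Type} [Finite ι] {m : ι → ℕ} {Y : ι → SchemeOver ℂ} (g : ∀ i, Y i ⟶ fiberOver f o)
    (hY : ∀ i, IsSmoothProjective (m i) (Y i))
    (hcov : ∀ x : ↥(fiberOver f o).left, ∃ (i : ι) (y : ↥(Y i).left), (g i).left.base y = x)
    (k : ℕ) (Θ : complexBetti 𝒳 k) (hΘ : ∀ i, IsRationalClass (complexBetti.map (g i ≫ fiberι f o) k Θ))
    (t : AlgPoints C ℂ) {n : ℕ} (ht : IsSmoothProjective n (fiberOver f t)) :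
    IsRationalClass (complexBetti.map (fiberι f t) k Θ) :=
  stub_rationalDescent h𝒳 (fun i => g i ≫ fiberι f o) hY (fiberι f t) ht k
    (fun x hx => boundaryReadout_vanishingReadout f o h𝒳 hC hf g hY hcov k x hx t ht) Θ hΘ

/-- **Hodge-type readout (σ-free, unconditional).** With `f`, `o`, `g_i` as above: a class
`Θ ∈ Hᵏ(𝒳(ℂ); ℂ)` whose restrictions to the covering pieces `Y_i` are of Hodge type `(a,b)` has
restriction of type `(a,b)` to every smooth projective fibre `X_t` (`boundaryReadout_vanishingReadout` +
`stub_typeDescent`). In particular the hypothesis `IsOfHodgeType … ξ` of `BoundaryAbsoluteness` is implied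
fibrewise by the hypotheses on the pieces. [cite: VoisinHodgeI2002, Thm. 6.18 and §7.3.2]
[cite: DeligneHodgeIII1974, Prop. 8.2.7] -/
theorem boundaryReadout_typeReadout {N : ℕ} {𝒳 C : SchemeOver ℂ} (f : 𝒳 ⟶ C) (o : AlgPoints C ℂ)
    (h𝒳 : IsSmoothProjective N 𝒳) (hC : IsSmoothProjective 1 C) (hf : Function.Surjective f.left.base)
    {ι : Type} [Finite ι] {m : ι → ℕ} {Y : ι → SchemeOver ℂ} (g : ∀ i, Y i ⟶ fiberOver f o)
    (hY : ∀ i, IsSmoothProjective (m i) (Y i))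
    (hcov : ∀ x : ↥(fiberOver f o).left, ∃ (i : ι) (y : ↥(Y i).left), (g i).left.base y = x)
    (k a b : ℕ) (Θ : complexBetti 𝒳 k)
    (hΘ : ∀ i, IsOfHodgeType (m i) (Y i) k a b (complexBetti.map (g i ≫ fiberι f o) k Θ))
    (t : AlgPoints C ℂ) {n : ℕ} (ht : IsSmoothProjective n (fiberOver f t)) :
    IsOfHodgeType n (fiberOver f t) k a b (complexBetti.map (fiberι f t) k Θ) :=
  stub_typeDescent h𝒳 (fun i => g i ≫ fiberι f o) hY (fiberι f t) ht k a b
    (fun x hx => boundaryReadout_vanishingReadout f o h𝒳 hC hf g hY hcov k x hx t ht) Θ hΘ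

/-- **The fibre kernel inclusion, on every conjugate family** (statement 5 of the line, unconditional):
for `f : 𝒳 ⟶ C` surjective from a smooth projective variety onto a smooth projective curve, smooth
projective pieces `g_i : Y_i ⟶ X_o` jointly covering the fibre over `o`, `σ ∈ Aut ℂ`, and a class
`x ∈ Hᵏ(𝒳^σ(ℂ); ℂ)` killed by every `((g_i ≫ ι_o)^σ)^*`: `(ι_t^σ)^* x = 0` for every `t` with `X_t`
smooth projective. The conjugate family `f^σ` is again such a surjection
(`IsSmoothProjective.conjugateVariety_holds`; surjectivity is stable under base change,
`Motives.isPullback_baseChangeHom_map_left`), its fibre over `o^σ` is covered by the conjugate pieces and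
its fibres are the conjugates of the fibres (`stub_conjugateFibre`); on it, the smooth-fibre locus
(`stub_smoothFibreLocus`) and vanishing propagation (`stub_vanishingPropagation`: Hodge III 8.2.7 + tube +
Ehresmann) conclude. [cite: DeligneHodgeIII1974, Prop. 8.2.7] [cite: Deligne1982HodgeCycles, §2 Thm. 2.12] -/
theorem boundaryReadout_fibreKernelInclusion :
    ∀ ⦃N : ℕ⦄ ⦃𝒳 C : SchemeOver ℂ⦄ (f : 𝒳 ⟶ C) (o : AlgPoints C ℂ),
      IsSmoothProjective N 𝒳 → IsSmoothProjective 1 C → Function.Surjective f.left.base →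
      ∀ ⦃ι : Type⦄ [Finite ι] ⦃m : ι → ℕ⦄ ⦃Y : ι → SchemeOver ℂ⦄ (g : ∀ i, Y i ⟶ fiberOver f o),
        (∀ i, IsSmoothProjective (m i) (Y i)) →
        (∀ x : ↥(fiberOver f o).left, ∃ (i : ι) (y : ↥(Y i).left), (g i).left.base y = x) →
        ∀ (σ : ℂ ≃+* ℂ) (k : ℕ) (x : complexBetti (conjugateVariety σ 𝒳) k),
          (∀ i, complexBetti.map (conjHom σ (g i ≫ fiberι f o)) k x = 0) →
          ∀ (t : AlgPoints C ℂ) ⦃n : ℕ⦄, IsSmoothProjective n (fiberOver f t) →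
            complexBetti.map (conjHom σ (fiberι f t)) k x = 0 := by
  intro N 𝒳 C f o h𝒳 hC₁ hf ι _ m Y g hY hcov σ k x hx t n ht
  obtain ⟨o', eo, heo⟩ := stub_conjugateFibre.1 f σ o
  obtain ⟨t', et, het⟩ := stub_conjugateFibre.1 f σ t
  -- the conjugate family is again a surjection from a smooth projective variety onto a smooth
  -- projective curve
  have h𝒳' : IsSmoothProjective N (conjugateVariety σ 𝒳) :=
    IsSmoothProjective.conjugateVariety_holds σ h𝒳
  have hC' : IsSmoothProjective 1 (conjugateVariety σ C) :=
    IsSmoothProjective.conjugateVariety_holds σ hC₁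
  have hf' : Function.Surjective (conjHom σ f).left.base := by
    haveI : Surjective f.left := ⟨hf⟩
    have hs : Surjective (conjHom σ f).left :=
      MorphismProperty.of_isPullback (P := @Surjective)
        (Literature.AlgebraicGeometry.Motives.isPullback_baseChangeHom_map_left σ.toRingHom f)
        ‹Surjective f.left›
    exact hs.surj
  -- the conjugate pieces cover the conjugate fibre
  let g' : ∀ i, conjugateVariety σ (Y i) ⟶ fiberOver (conjHom σ f) o' :=
    fun i => conjHom σ (g i) ≫ eo.hom
  have hY' : ∀ i, IsSmoothProjective (m i) (conjugateVariety σ (Y i)) := fun i =>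
    IsSmoothProjective.conjugateVariety_holds σ (hY i)
  have hcov' : ∀ x' : ↥(fiberOver (conjHom σ f) o').left,
      ∃ (i : ι) (y : ↥(conjugateVariety σ (Y i)).left), (g' i).left.base y = x' := by
    intro x'
    obtain ⟨i, y', hy'⟩ := stub_conjugateFibre.2 g σ hcov (eo.inv.left.base x')
    refine ⟨i, y', ?_⟩
    have hcomp : (g' i).left.base y' = eo.hom.left.base ((conjHom σ (g i)).left.base y') := by
      change (conjHom σ (g i) ≫ eo.hom).left.base y' = _
      simp only [Over.comp_left, Scheme.Hom.comp_base, TopCat.comp_app]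
    have hid : eo.hom.left.base (eo.inv.left.base x') = x' := by
      have h1 : (eo.inv ≫ eo.hom).left.base x' = x' := by
        rw [eo.inv_hom_id]
        simp only [Over.id_left, Scheme.Hom.id_base, TopCat.id_app]
      simpa only [Over.comp_left, Scheme.Hom.comp_base, TopCat.comp_app] using h1
    rw [hcomp, hy', hid]
  -- the hypothesis on the pieces, rewritten on the conjugate family
  have hx' : ∀ i, complexBetti.map (g' i ≫ fiberι (conjHom σ f) o') k x = 0 := by
    intro i
    have hfun : g' i ≫ fiberι (conjHom σ f) o' = conjHom σ (g i ≫ fiberι f o) := by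
      change (conjHom σ (g i) ≫ eo.hom) ≫ fiberι (conjHom σ f) o' = _
      rw [Category.assoc, heo]
      exact ((baseChangeHom σ.toRingHom).map_comp (g i) (fiberι f o)).symm
    rw [hfun]
    exact hx i
  -- the smooth-fibre locus of the conjugate family and the conjugate of the smooth fibre `X_t`
  obtain ⟨W, d, hW, hmem⟩ := stub_smoothFibreLocus (conjHom σ f) h𝒳' hC' hf'
  have ht' : IsSmoothProjective n (fiberOver (conjHom σ f) t') :=
    IsSmoothProjective.of_iso et (IsSmoothProjective.conjugateVariety_holds σ ht)
  have key : complexBetti.map (fiberι (conjHom σ f) t') k x = 0 :=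
    stub_vanishingPropagation (conjHom σ f) o' h𝒳' hC' hf' g' hY' hcov' W d hW k x hx' t' (hmem t' ht')
  -- transport back along `(X_t)^σ ≅ (𝒳^σ)_{t'}`
  rw [← het, complexBetti.map_comp, ModuleCat.comp_apply, key, map_zero]

/-- **Absoluteness descends along conjugation-stable kernel inclusions** (the census's arithmetic
statement `KernelDescent`, CONDITIONAL on the named facts (J), (G), (C) of `ConjugationChartExistence`
and on `chartConjugation_canonical` of `ConjugationChartUniqueness`). For `X` smooth projective, smooth projective `h_i : Y_i ⟶ X`,
`w : W ⟶ X` with `⋂ ker (h_i^σ)^* ⊆ ker (w^σ)^*` on every conjugate, and a rational `(p,p)` class `ξ`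
absolute Hodge on every `Y_i`: `w^* ξ` is absolute Hodge. For a conjugate `c'` of `w^* ξ`: name a
conjugate `Ξ'` of `ξ` (existence, `exists_isConjugateClass_of_facts'`), put `Θ := (2πi/σ(2πi))^{-p} Ξ'`;
by functoriality `c' = (w^σ)^* Ξ'` and the conjugates of the `h_i^* ξ` given by the hypothesis are the
`(h_i^σ)^* Ξ'`, so `Θ` restricts on the conjugate pieces to rational `(p,p)` classes; rationality
(`stub_rationalDescent`) and type (`stub_typeDescent`) descend along the kernel inclusion on `X^σ`.
[cite: CharlesSchnell2014Notes, Def. 11.2.3 and §11.2.2] [cite: Deligne1982HodgeCycles, §2 Lemma 2.13] -/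
theorem boundaryReadout_kernelDescent_of_facts (hJ : jouanolou_cohomologyChart)
    (hG : grothendieck_comparison_realize_surjective) (hC : conj_realize_mem_cclosedSmoothForms)
    (hN : chartConjugation_canonical) :
    ∀ ⦃n : ℕ⦄ ⦃X : SchemeOver ℂ⦄, IsSmoothProjective n X →
      ∀ ⦃ι : Type⦄ [Finite ι] ⦃m : ι → ℕ⦄ ⦃Y : ι → SchemeOver ℂ⦄ (h : ∀ i, Y i ⟶ X),
        (∀ i, IsSmoothProjective (m i) (Y i)) →
        ∀ ⦃nW : ℕ⦄ ⦃W : SchemeOver ℂ⦄ (w : W ⟶ X), IsSmoothProjective nW W →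
          (∀ (σ : ℂ ≃+* ℂ) (k : ℕ) (x : complexBetti (conjugateVariety σ X) k),
            (∀ i, complexBetti.map (conjHom σ (h i)) k x = 0) →
              complexBetti.map (conjHom σ w) k x = 0) →
          ∀ (p : ℕ) (ξ : complexBetti X (2 * p)), IsRationalClass ξ → IsOfHodgeType n X (2 * p) p p ξ →
            (∀ i, IsAbsoluteHodgeClass (m i) (Y i) p (complexBetti.map (h i) (2 * p) ξ)) →
            IsAbsoluteHodgeClass nW W p (complexBetti.map w (2 * p) ξ) := by
  have h₁ : ∀ ⦃n : ℕ⦄ ⦃X : SchemeOver ℂ⦄, IsSmoothProjective n X →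
      ∀ (σ : ℂ ≃+* ℂ) (k : ℕ) (c : complexBetti X k), ∃ c', IsConjugateClass σ X k c c' :=
    exists_isConjugateClass_of_facts' hJ hG hC
  intro n X hX ι _ m Y h hY nW W w hW hker p ξ hξr hξh habs
  -- functoriality + single-valuedness of conjugation, from `chartConjugation_canonical`
  have hN' : ∀ ⦃m' n' : ℕ⦄ ⦃Y' X' : SchemeOver ℂ⦄, IsSmoothProjective m' Y' → IsSmoothProjective n' X' →
      ∀ (g : Y' ⟶ X') (σ : ℂ ≃+* ℂ) (k : ℕ) (c : complexBetti X' k)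
        (c' : complexBetti (conjugateVariety σ X') k) (d' : complexBetti (conjugateVariety σ Y') k),
        IsConjugateClass σ X' k c c' → IsConjugateClass σ Y' k (complexBetti.map g k c) d' →
          d' = complexBetti.map (conjHom σ g) k c' :=
    fun m' n' Y' X' hY' hX' g σ k c c' d' hc' hd' =>
      (conjugateNaturality_of_chartConjugation_canonical hN hY' hX' g σ k c c' d' hc' hd').symm
  -- the `(p,p)` type of `w^* ξ` (proved tree theorem: pull-backs preserve Hodge types)
  have hpp : IsOfHodgeType nW W (2 * p) p p (complexBetti.map w (2 * p) ξ) :=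
    hξh.map_of_isSmoothProjective hW hX w
  refine ⟨hξr.pullback _, hpp, fun σ => ⟨h₁ hW σ (2 * p) _, fun c' hc' => ?_⟩⟩
  -- a conjugate `Ξ'` of the class `ξ` on `X^σ`
  obtain ⟨Ξ', hΞ'⟩ := h₁ hX σ (2 * p) ξ
  -- functoriality: the given conjugate of `w^* ξ` is the pull-back of `Ξ'`
  have hc'eq : c' = complexBetti.map (conjHom σ w) (2 * p) Ξ' :=
    hN' hW hX w σ (2 * p) ξ Ξ' c' hΞ' hc'
  -- the untwisted conjugate
  obtain ⟨Θ, hΘ⟩ : ∃ Θ : complexBetti (conjugateVariety σ X) (2 * p), Θ = (periodTwist σ p)⁻¹ • Ξ' :=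
    ⟨_, rfl⟩
  have htw : periodTwist σ p ≠ 0 := periodTwist_ne_zero σ p
  -- `Θ` restricts on every conjugate piece `Y_i^σ` to the RATIONAL `(p,p)`-class `β_i`
  have hΘY : ∀ i, IsRationalClass (complexBetti.map (conjHom σ (h i)) (2 * p) Θ) ∧
      IsOfHodgeType (m i) (conjugateVariety σ (Y i)) (2 * p) p p
        (complexBetti.map (conjHom σ (h i)) (2 * p) Θ) := by
    intro i
    obtain ⟨d, hd⟩ := ((habs i).2.2 σ).1
    obtain ⟨βi, hβi, hβiH, hdβ⟩ := ((habs i).2.2 σ).2 d hd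
    have hdΞ : d = complexBetti.map (conjHom σ (h i)) (2 * p) Ξ' :=
      hN' (hY i) hX (h i) σ (2 * p) ξ Ξ' d hΞ' hd
    have hΘi : complexBetti.map (conjHom σ (h i)) (2 * p) Θ = βi := by
      rw [hΘ, map_smul, ← hdΞ, hdβ, smul_smul, inv_mul_cancel₀ htw, one_smul]
    rw [hΘi]
    exact ⟨hβi, hβiH⟩
  -- the conjugate varieties are smooth projective (PROVED tree theorem)
  have hX' : IsSmoothProjective n (conjugateVariety σ X) := IsSmoothProjective.conjugateVariety_holds σ hX
  have hY' : ∀ i, IsSmoothProjective (m i) (conjugateVariety σ (Y i)) := fun i =>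
    IsSmoothProjective.conjugateVariety_holds σ (hY i)
  have hW' : IsSmoothProjective nW (conjugateVariety σ W) := IsSmoothProjective.conjugateVariety_holds σ hW
  -- descent along the kernel inclusion on `X^σ`, twice: rationality and Hodge type
  have hβ : IsRationalClass (complexBetti.map (conjHom σ w) (2 * p) Θ) :=
    stub_rationalDescent hX' (fun i => conjHom σ (h i)) hY' (conjHom σ w) hW' (2 * p) (hker σ (2 * p)) Θ
      (fun i => (hΘY i).1)
  have hβH : IsOfHodgeType nW (conjugateVariety σ W) (2 * p) p p
      (complexBetti.map (conjHom σ w) (2 * p) Θ) :=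
    stub_typeDescent hX' (fun i => conjHom σ (h i)) hY' (conjHom σ w) hW' (2 * p) p p (hker σ (2 * p)) Θ
      (fun i => (hΘY i).2)
  have hc'β : c' = periodTwist σ p • complexBetti.map (conjHom σ w) (2 * p) Θ := by
    rw [hc'eq, hΘ, map_smul, smul_smul, mul_inv_cancel₀ htw, one_smul]
  exact ⟨_, hβ, hβH, hc'β⟩

/-- **`BoundaryAbsoluteness` (boundary Principle B) modulo the named facts of conjugation** — the line
`typewise_readout` of the crux stmt-HodgeConjecture-15913 assembled: Jouanolou's cohomology chart (J),
Grothendieck's comparison on smooth affines (G), closedness of conjugate realisations (C) and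
canonicity of chart conjugation (`chartConjugation_canonical`) imply the crux BY NAME —
`boundaryReadout_kernelDescent_of_facts` at `X = 𝒳`, `h_i = g_i ≫ ι_o`, `w = ι_t`, its kernel
hypothesis on every conjugate family being the unconditional `boundaryReadout_fibreKernelInclusion`.
CONDITIONAL result (the item closes only when the four facts are discharged).
[cite: Deligne1982HodgeCycles, §2 Thm. 2.12] [cite: DeligneHodgeIII1974, Prop. 8.2.7]
[cite: CharlesSchnell2014Notes, §11.2.2 and Thm. 11.3.8] -/
theorem boundaryAbsoluteness_of_facts (hJ : jouanolou_cohomologyChart)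
    (hG : grothendieck_comparison_realize_surjective) (hC : conj_realize_mem_cclosedSmoothForms)
    (hN : chartConjugation_canonical) : BoundaryAbsoluteness := by
  intro N p 𝒳 C f o h𝒳 hC₁ hf ι _ m Y g hY hcov ξ hξr hξh habs t n ht
  exact boundaryReadout_kernelDescent_of_facts hJ hG hC hN h𝒳 (fun i => g i ≫ fiberι f o) hY
    (fiberι f t) ht
    (fun σ k x hx => boundaryReadout_fibreKernelInclusion f o h𝒳 hC₁ hf g hY hcov σ k x hx t ht)
    p ξ hξr hξh habs

end Summit.HodgeConjecture.HodgeConjecture.Theorems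

end
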